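import Summits.ResolutionOfSingularities.ResolutionOfSingularities.Theorems.PurelyInseparableDim4ResConeLightTripleEntry
import Summits.ResolutionOfSingularities.ResolutionOfSingularities.Theorems.PurelyInseparableDim4ResConeLightWeights
import HarnessLib
import HarnessLib.Audit.Tags

/-!
# Purely inseparable four-folds — the LIGHT `d = 3` TAIL at `p = 5` (K27a): every satellite step of a
# power-cone stretch is light; the trichotomy; (T1) free tail ✗, (T3) triple regime ✗, (T2) by value

[OURS · counted 0 · cell `res-dim4-pi` · K2(p) lane holder res-dim4-p-12 g3's brick (K27a) «THE d = 3 ASSEMBLY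
at p = 5» by signature (bus 2026-08-29 01:38Z), seat res-dim4-p-2 g4 (lineage res-dim4-p-2).]  Nothing here
proves K2(5): this file closes the `d = 3` light power-cone regime at `p = 5` MODULO the two-slot branch (T2),
taken BY VALUE as the hypothesis `hT2` until res-dim4-p-1 g3's K24a lands (then an unconditional corollary is
appended); the `d = 2`, `d = 4` (C∞) light regimes and the binary-cone slice are separate.  Nothing here proves
`NoIsolatedTrap 5 5` or resolution of singularities in dimension ≥ 4 / characteristic `p`.  AI kernel work,
weaker than expert review.

* §1 **`satellite_light_of_powerCone`** (every `p`, `2 ≤ d < p`) — on a power-cone stretch with frame data EVERY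
  satellite step `k ≥ k₀` is light, `o_k + o_{k+1} + 3 ≤ 3p`: the two letters created at `k`, `k + 1` are
  stretch-born and kept at `k + 2` (res-dim4-p-1 g3's K12a `stretchBorn_pair_of_satellite`), and
  res-dim4-p-2 g3's K11b `stretch_no_heavy_pair_of_lt` forbids a heavy pair (the argument of K12c
  `frequently_light_satellite`, stated for every satellite step).
* §2 **`no_light_powerCone_tail_three_five_of`** (`p = 5`, `d = 3`) — from the slice-B chain block (witnessed
  isolated above-floor `Step0 5` chain, `x^{r₀} ∣ F₀`, shade `3` and `e_G = 3` from `k₀`) and `hT2`: `False`.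
  Route: `chain_powerCone_package` (frame data) ⇒ §1 ⇒ res-dim4-p-9 g3's K26a `light_weights` (free tail, or all
  weights `≤ 1` with `|r| = 3`, hence exactly three boundary letters) ⇒ K26b `light_tail_trichotomy` ⇒
  (T1) the tree's free-tail theorem `FreeTailProof.noIsolatedFreeTailAt_self` · (T2) `hT2` · (T3) K25d
  `no_light_triple_regime_of_born_five`.
bears_on: LADDER-RESOLUTION:D157-DOOR2 (res-dim4-pi · K2(p) · slice B · K27a).  Supports
stmt-ResolutionOfSingularities-16155 (helper).
-/

set_option linter.dupNamespace false -- mandated namespace of this single-conjunct summit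

noncomputable section

namespace Summit.ResolutionOfSingularities.ResolutionOfSingularities.Theorems.PIDim4

namespace ResCone

open MvPolynomial Finset
open Literature.AlgebraicGeometry.Resolution
open Literature.AlgebraicGeometry.Resolution.CentreBlowup
open Literature.AlgebraicGeometry.Resolution.Hauser2010
open Literature.AlgebraicGeometry.Resolution.HauserPerlega2019
open PointBlowup (polarMap additiveSubspace direction)

variable {K : Type} [Field K]

/-! ## 1. Every satellite step of a power-cone stretch is light -/

/-- **EVERY SATELLITE STEP OF A POWER-CONE STRETCH IS LIGHT** (`o_k + o_{k+1} + 3 ≤ 3p` for every satellite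
`k ≥ k₀`): the letters created at `k` and `k + 1` are both present at `c (k+2)` with
`r(j k) + r(j (k+1)) = o_k + o_{k+1} − 2p`, both stretch-born and kept, so K11b forbids `p ≤ r + r + 2`. [OURS]
[cite: CossartJannsenSaito2020, Thm. 3.10(4), Thm. 3.14] -/
theorem satellite_light_of_powerCone (p : ℕ) [Fact p.Prime] [CharP K p] [DecidableEq K]
    {c : ℕ → State K} {j : ℕ → Fin 4} {b : ℕ → Fin 4 → K}
    (hc : ∀ k, IsIsolated p (c k).F ∧ Step0 p (c k) (c (k + 1))) (hw : FreeTail.IsWitnessedChain p c j b)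
    (hr0 : ∀ e ∈ (c 0).F.support, (c 0).r ≤ e) (hfloor : ∀ k, ordZero (c k).F ≠ p) {k₀ d : ℕ} (hd2 : 2 ≤ d)
    (hdp : d < p) (hshade : ∀ k, k₀ ≤ k → (c k).shade = (d : ℕ∞)) {ℓ : ℕ → Fin 4 → K} {a0 lam : ℕ → K}
    (hform : ∀ k, k₀ ≤ k → resForm (c k) = C (a0 k) * (∑ i, C (ℓ k i) * X i) ^ d)
    (hdir : ∀ k, k₀ ≤ k → ℓ k (j k) + dotProduct (ℓ k) (b k) = 0) (hlam : ∀ k, k₀ ≤ k → lam k ≠ 0)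
    (hprop : ∀ k, k₀ ≤ k → ∀ i, i ≠ j k → ℓ (k + 1) i = lam k * ℓ k i)
    (hcarry : ∀ k, k₀ ≤ k → ∃ i, i ≠ j k ∧ ℓ k i ≠ 0) {k : ℕ} (hk : k₀ ≤ k) (hsat : FreeTail.IsSatellite j b k)
    {oₖ oₖ₁ : ℕ} (hoₖ : ordZero (c k).F = oₖ) (hoₖ₁ : ordZero (c (k + 1)).F = oₖ₁) : oₖ + oₖ₁ + 3 ≤ 3 * p := by
  obtain ⟨oₖ', oₖ₁', hoₖ', hoₖ₁', -, -, -, ha, hb, hkept₁, hkept₂⟩ := stretchBorn_pair_of_satellite p hc hw hfloor hsat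
  have e1 : oₖ' = oₖ := by have h := hoₖ'.symm.trans hoₖ; exact_mod_cast h
  have e2 : oₖ₁' = oₖ₁ := by have h := hoₖ₁'.symm.trans hoₖ₁; exact_mod_cast h
  subst e1; subst e2
  by_contra hlt
  refine stretch_no_heavy_pair_of_lt p hc hw hr0 hfloor hd2 hdp hshade hform hdir hlam hprop hcarry
    (k₁ := k) (k₂ := k + 1) (k := k + 2) hk (Nat.lt_succ_self k) (by omega) hsat.1.symm hkept₁ hkept₂ ?_
  rw [ha, hb]
  omega

/-! ## 2. The `d = 3` light tail at `p = 5`, modulo the two-slot branch -/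

/-- Weights `≤ 1` of total `3` mean exactly three boundary letters. [folklore] -/
theorem card_support_eq_three_of_weights {r : Fin 4 →₀ ℕ} (h1 : ∀ i, r i ≤ 1) (hdeg : r.degree = 3) :
    r.support.card = 3 := by
  classical
  have hsum : r.degree = ∑ i, r i := Finsupp.degree_eq_sum _
  have hsupp : r.support = Finset.univ.filter (fun i => r i = 1) := by
    ext i
    rw [Finsupp.mem_support_iff, Finset.mem_filter]
    have := h1 i
    constructor
    · intro h; exact ⟨Finset.mem_univ i, by omega⟩
    · intro h; omega
  rw [hsupp]
  have key : ∑ i, r i = (Finset.univ.filter (fun i => r i = 1)).card := by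
    rw [Finset.card_eq_sum_ones, Finset.sum_filter]
    exact Finset.sum_congr rfl fun i _ => by have := h1 i; split_ifs with h <;> omega
  omega

/-- **THE LIGHT `d = 3` TAIL AT `p = 5`, MODULO THE TWO-SLOT BRANCH (T2)** (K27a; statement in the module
docstring): a witnessed isolated above-floor `Step0 5` chain with `x^{r₀} ∣ F₀` cannot have shade `3` and `e_G = 3`
from some index on — GIVEN, by value, that the two-slot configuration (T2) of the light-tail trichotomy (one idle
boundary letter, the other two stretch-born) is contradictory on this chain (res-dim4-p-1 g3's K24a). [OURS]
[cite: CossartJannsenSaito2020, Thm. 3.10(4), Thm. 3.14, Thm. 9.3] -/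
theorem no_light_powerCone_tail_three_five_of [CharP K 5] [DecidableEq K] {c : ℕ → State K} {j : ℕ → Fin 4}
    {b : ℕ → Fin 4 → K} (hc : ∀ k, IsIsolated 5 (c k).F ∧ Step0 5 (c k) (c (k + 1)))
    (hw : FreeTail.IsWitnessedChain 5 c j b) (hr0 : ∀ e ∈ (c 0).F.support, (c 0).r ≤ e)
    (hfloor : ∀ k, ordZero (c k).F ≠ (5 : ℕ)) {k₀ : ℕ} (hshade : ∀ k, k₀ ≤ k → (c k).shade = ((3 : ℕ) : ℕ∞))
    (he3 : ∀ k, k₀ ≤ k → Module.finrank K (resVertex (c k)) = 3)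
    (hT2 : ∀ (ν : Fin 4) (k₁ : ℕ), k₀ ≤ k₁ → (∀ k, k₁ ≤ k → 1 ≤ (c k).r ν ∧ j k ≠ ν ∧ b k ν = 0) →
      (∀ k, k₁ ≤ k → ∀ i, i ≠ ν → 1 ≤ (c k).r i →
        ∃ t, k₀ ≤ t ∧ t < k ∧ j t = i ∧ ∀ m, t < m → m < k → j m ≠ i ∧ b m i = 0) → False) : False := by
  haveI : Fact (Nat.Prime 5) := ⟨by norm_num⟩
  -- the frame data of the power-cone stretch
  obtain ⟨ℓ, a0, lam, hpkg⟩ := chain_powerCone_package 5 hc hw hr0 hfloor (by norm_num) hshade he3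
  have hform : ∀ k, k₀ ≤ k → resForm (c k) = C (a0 k) * (∑ i, C (ℓ k i) * X i) ^ 3 :=
    fun k hk => (hpkg k hk).2.2.1
  have hdir : ∀ k, k₀ ≤ k → ℓ k (j k) + dotProduct (ℓ k) (b k) = 0 := fun k hk => (hpkg k hk).2.2.2.1
  have hlam : ∀ k, k₀ ≤ k → lam k ≠ 0 := fun k hk => (hpkg k hk).2.2.2.2.1
  have hprop : ∀ k, k₀ ≤ k → ∀ i, i ≠ j k → ℓ (k + 1) i = lam k * ℓ k i :=
    fun k hk => (hpkg k hk).2.2.2.2.2.1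
  have hcarry : ∀ k, k₀ ≤ k → ∃ i, i ≠ j k ∧ ℓ k i ≠ 0 := fun k hk => (hpkg k hk).2.2.2.2.2.2
  -- every satellite step is light
  have hlight : ∀ k, k₀ ≤ k → FreeTail.IsSatellite j b k → ∀ oₖ oₖ₁ : ℕ,
      ordZero (c k).F = oₖ → ordZero (c (k + 1)).F = oₖ₁ → oₖ + oₖ₁ + 3 ≤ 15 := by
    intro k hk hsat oₖ oₖ₁ hoₖ hoₖ₁
    have h := satellite_light_of_powerCone 5 hc hw hr0 hfloor (by norm_num) (by norm_num) hshade hform hdir hlam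
      hprop hcarry hk hsat hoₖ hoₖ₁
    omega
  have hfloor' : ∀ k, ordZero (c k).F ≠ 5 := fun k => by have h := hfloor k; exact_mod_cast h
  have hFT : ∀ k₁, (∀ k, k₁ ≤ k → ¬ FreeTail.IsSatellite j b k) → False := fun k₁ hfree => by
    obtain ⟨k, hk⟩ := FreeTailProof.noIsolatedFreeTailAt_self 5 K c j b k₁ hw hfree
    exact hk (hc k).1
  -- K26a: free tail, or weights `≤ 1` with `|r| = 3`
  rcases light_weights hc hw hfloor' hshade hlight with ⟨k₁, -, hfree⟩ | hwt
  · exact hFT k₁ hfree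
  have hB3 : ∀ k, k₀ ≤ k → (c k).r.support.card = 3 :=
    fun k hk => card_support_eq_three_of_weights (hwt k hk).1 (hwt k hk).2
  -- K26b: the trichotomy
  rcases light_tail_trichotomy 5 hc hw hfloor hB3 with ⟨k₁, -, hfree⟩ | ⟨ν, k₁, hk₁, hidle, hborn⟩ | ⟨k₁, hk₁, hT3⟩
  · exact hFT k₁ hfree
  · exact hT2 ν k₁ hk₁ hidle hborn
  · exact no_light_triple_regime_of_born_five hc hw hr0 hfloor rfl hshade hform hdir hlam hprop hcarry hB3 hk₁ hT3

end ResCone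

end Summit.ResolutionOfSingularities.ResolutionOfSingularities.Theorems.PIDim4

end
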